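import Summits.ABC.IUTFork.Cor312LicenceTripleUnconditionalSlot
import Summits.ABC.IUTFork.Conditional.WRowFrey73SmallLevelsCellsA
import Summits.ABC.IUTFork.Conditional.WRowFrey73SmallLevelsCellsB
import HarnessLib

/-!
# R-W WINDOW-TABLE «W:INHABITED-BANDS-B» — the abc triple `73 + 2¹³·7⁷·941² = 3¹⁶·103³·127` at the levels `l = 5, 7, 17, 23`: the hull licence S_H
# HOLDS at EVERY genuine Θ-volume datum over `(ratPoint (73/5973865915867209), l)` — the complement of `WRowFrey73AllLevels` below `29`

PROOF-ONLY file (D-0012; 0 definitions, 0 `Prop` facts) of the abc-iut cell — D-0079 RESCUE sub-cell R-W «WINDOW Θ-SIDE INEQUALITY», W1 ROW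
DECISIONS seat abc-iut-W-row-2 (gen 2), claim «W:INHABITED-BANDS-B» (abc-iut-plan rulings C-R75 / C-R77 / C-R79 «below 29»). `WRowFrey73AllLevels`
(p488605) decides EVERY prime `l ≥ 29`; this file adds the four levels `5, 7, 17, 23`, instantiating abc-iut-W-row-1's INTEGER-SLOT socket
`WRow.licence_triple_unconditional_slot` / `WRow.exists_qPinned_and_hull_triple_unconditional_slot` (`Cor312LicenceTripleUnconditionalSlot`, p488934;
inner radius `max(1, ⌊e/(p−1)⌋)` at every odd bad prime — abc-iut-c312-5's slot) at the arithmetic `WRow.hcell_frey73_small57` / `WRow.hcell_frey73_small1723`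
(`WRowFrey73SmallLevelsCellsA/B`). With the all-levels theorem the triple's window hypothesis S_H is DECIDED-INHABITED at every prime level EXCEPT
`l ∈ {11, 13, 19}` — where, by the desk sweep (work/small73plan.py, staged), NO envelope exponent makes even the exact cells hold (prime `103` at
`11, 13`, prime `7` at `19`): the triple's honest residual on the inhabited side. TAKES NO SIDE on [IUTchIII] Cor. 3.12 (S. Mochizuki,
*Inter-universal Teichmüller theory III*, Cor. 3.12 p. 173–174; Step (xi-f) p. 184) or on any author; «inhabited as typed» ≠ «asserted in print».

WHAT IS PROVED (namespace `Summit.ABC.IUTFork.Conditional`): **`WRow.licence_frey73_small`** — for `l ∈ {5, 7, 17, 23}`, EVERY genuine Θ-volume datum `T`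
at `(ratPoint (73/5973865915867209), l)` and EVERY pair of realising Θ- and q-ideles, abc-iut-c312-1's `Thm311ToCor312.Licence` HOLDS at
`settingPrVolSharp (pilotDataOfK T.D T.K) …`; **`WRow.exists_qPinned_and_hull_frey73_small`** — branch C's «∃ ρ qK, QPinned ∧ PilotKummerCompatHull»
there, any columns. READING (neutral; numbers, not adjectives): hypothesis-free; admissibility / (P6) / Szpiro-badness of `(ratPoint λ, l)` and
NON-EMPTINESS of the datum type are NOT claimed. HONEST SCOPE: OUR sharp containers; STRONGER-THAN-PRINT hull reading; nothing about the printed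
inequality or any author's intended hull; typed ≠ proved; instantiated ≠ endorsed; no abc claim.
[cite: Mochizuki2012, IUTchI Def. 3.1 (b),(c) pp. 61–62, Rmk. 3.1.5 p. 65, Ex. 3.2 (iv) p. 71; IUTchIII Cor. 3.12 Step (xi-f) p. 184; IUTchIV Prop. 1.1 p. 9, Prop. 1.2 (i)(ii) p. 10, Prop. 1.4 (ii) p. 13, Cor. 2.2 (ii) proof (P5) p. 46]
[cite: DupuyHilado2025, §3.3, §3.4, §4.9, §4.12] [cite: NeukirchANT1999, Ch. II (5.5)–(5.7)] [claim: Mochizuki2012, status: disputed] for every IUT sentence.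
-/

noncomputable section

open Set Function Metric NumberField IsDedekindDomain

namespace Summit.ABC.IUTFork.Conditional

open Thm311 Thm311.Real Cor312 Cor312Vol Cor312Prov Literature.IUT.LogThetaLattice Literature.IUT.LogVolume
  Literature.IUT.HodgeTheaters Literature.IUT.LogVolume.Cor22
open Literature.NumberTheory.NumberFields Literature.NumberTheory.GaloisRepresentations.Ultrametric
open Literature.NumberTheory.DiophantineGeometry Literature.NumberTheory.DiophantineGeometry.GenEll

/-! ## S_H INHABITED at every genuine datum over `(ratPoint (73/5973865915867209), l)`, `l ∈ {5, 7, 17, 23}` -/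

/-- **«W:INHABITED-BANDS-B», `73 + 2¹³·7⁷·941² = 3¹⁶·103³·127`, levels `l ∈ {5, 7, 17, 23}`**: for every genuine Θ-volume datum `T` at
`(ratPoint (73/5973865915867209), l)` ([IUTchIV] Cor. 2.2 (ii) proof (P7)) and every pair of Θ- and q-ideles realising the pilot divisors of
`X := pilotDataOfK T.D T.K`, abc-iut-c312-1's `Thm311ToCor312.Licence` HOLDS at abc-iut-c312-7's `settingPrVolSharp X …` — abc-iut-W-row-1's
`WRow.licence_triple_unconditional_slot` at `WRow.hcell_frey73_small57` / `WRow.hcell_frey73_small1723`.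
[cite: Mochizuki2012, IUTchI Def. 3.1 (b),(c) pp. 61–62, Rmk. 3.1.5 p. 65, Ex. 3.2 (iv) p. 71; IUTchIII Cor. 3.12 Step (xi-f) p. 184; IUTchIV Prop. 1.1 p. 9, Prop. 1.2 (i)(ii) p. 10, Prop. 1.4 (ii) p. 13, Cor. 2.2 (ii) proof (P5) p. 46] [cite: DupuyHilado2025, §3.3, §3.4, §4.9, §4.12] [claim: Mochizuki2012, status: disputed] -/
theorem WRow.licence_frey73_small (l : ℕ) (hl : l = 5 ∨ l = 7 ∨ l = 17 ∨ l = 23) (T : Cor22.ThetaVolumeDatumAt (ratPoint (((73 : ℕ) : ℚ) / (5973865915867209 : ℕ))) l) :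
    letI := T.instFieldF; letI := T.instNumberFieldF; letI := T.instAlgebraF; letI := T.instFieldK
    letI := T.instNumberFieldK; letI := T.instAlgebraK; letI := T.instFieldFbar; letI := T.instAlgebraFbar
    letI := T.instAlgebraKFbar; letI := T.instIsElliptic
    ∀ {logv : PadicLogs T.K} (hlog : LogvAnalytic logv) (M : Type) [Field M] [NumberField M]
      (archPk : ∀ (j : (thetaIndex (pilotDataOfK T.D T.K)).Label) (vQ : (thetaIndex (pilotDataOfK T.D T.K)).VQ),
        Set ((logShellsDH (pilotDataOfK T.D T.K) logv).Packet j vQ))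
      (archSub : ∀ (j : (thetaIndex (pilotDataOfK T.D T.K)).Label) (v : (thetaIndex (pilotDataOfK T.D T.K)).V),
        Set ((logShellsDH (pilotDataOfK T.D T.K) logv).Packet j ((thetaIndex (pilotDataOfK T.D T.K)).over v)))
      (Ψ : ℤ → ∀ v : (thetaIndex (pilotDataOfK T.D T.K)).V, v ∈ (thetaIndex (pilotDataOfK T.D T.K)).Vbad →
        Set ((logShellsDH (pilotDataOfK T.D T.K) logv).StarPacket v))
      (act : ℤ → ∀ v : (thetaIndex (pilotDataOfK T.D T.K)).V, v ∈ (thetaIndex (pilotDataOfK T.D T.K)).Vbad →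
        (logShellsDH (pilotDataOfK T.D T.K) logv).StarPacket v → Module.End ℚ ((logShellsDH (pilotDataOfK T.D T.K) logv).StarPacket v))
      (Mmod : ℤ → ∀ j : (thetaIndex (pilotDataOfK T.D T.K)).LabelStar, Set ((logShellsDH (pilotDataOfK T.D T.K) logv).GlobalPacket j.1))
      (region : ℤ → ∀ j : (thetaIndex (pilotDataOfK T.D T.K)).LabelStar, FinDivisor M → ∀ vQ : (thetaIndex (pilotDataOfK T.D T.K)).VQ,
        Set ((logShellsDH (pilotDataOfK T.D T.K) logv).Packet j.1 vQ))
      (n : ℤ) {HT : Type} {LogLink : HT → HT → Type} {IsFull : ∀ {s t : HT}, LogLink s t → Prop}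
      (lat : LGPGaussianLogThetaLattice LogLink IsFull)
      {Frd : Type} {IsoF : Frd → Frd → Type} {Ob : Frd → Type} {realify : Frd → Frd} {Strip : Type}
      {IsoS : Strip → Strip → Type} {Mv : ∀ v : (thetaIndex (pilotDataOfK T.D T.K)).V, v ∈ (thetaIndex (pilotDataOfK T.D T.K)).Vbad → Type}
      [∀ v h, Monoid (Mv v h)]
      (sig : GlobalLGPFrobenioidSignature (thetaIndex (pilotDataOfK T.D T.K)).lstar (thetaIndex (pilotDataOfK T.D T.K)).V
        (· ∈ (thetaIndex (pilotDataOfK T.D T.K)).Vbad) Frd IsoF Ob realify Strip IsoS Mv)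
      (split : SplittingMonoids Mv) {ObΔ : Type} {N : ∀ v : (thetaIndex (pilotDataOfK T.D T.K)).V, v ∈ (thetaIndex (pilotDataOfK T.D T.K)).Vbad → Type}
      [∀ v h, Monoid (N v h)] (qData : QPilotData ObΔ N)
      (tq : ∀ (pp : Nat.Primes) (x : (thetaIndex (pilotDataOfK T.D T.K)).Fibre (.inr pp)),
        haveI : Fact (pp : ℕ).Prime := ⟨pp.2⟩; kOf (pilotDataOfK T.D T.K) pp.1 x)
      (t : ∀ (pp : Nat.Primes) (_ : Fin (pilotDataOfK T.D T.K).lstar) (x : (thetaIndex (pilotDataOfK T.D T.K)).Fibre (.inr pp)),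
        haveI : Fact (pp : ℕ).Prime := ⟨pp.2⟩; kOf (pilotDataOfK T.D T.K) pp.1 x)
      (htq0 : ∀ pp x, tq pp x ≠ 0)
      (htq1 : ∀ (pp : Nat.Primes) (x : (thetaIndex (pilotDataOfK T.D T.K)).Fibre (.inr pp)),
        haveI : Fact (pp : ℕ).Prime := ⟨pp.2⟩; placeOf (pilotDataOfK T.D T.K) pp.1 x ∉ (pilotDataOfK T.D T.K).S → ‖tq pp x‖ = 1)
      (_ht0 : ∀ pp i x, t pp i x ≠ 0)
      (_ht : ∀ (pp : Nat.Primes) (i : Fin (pilotDataOfK T.D T.K).lstar) (x : (thetaIndex (pilotDataOfK T.D T.K)).Fibre (.inr pp)),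
        haveI : Fact (pp : ℕ).Prime := ⟨pp.2⟩
        Real.log ‖t pp i x‖ = -((pilotDataOfK T.D T.K).thetaPilot i (placeOf (pilotDataOfK T.D T.K) pp.1 x)) *
          logNorm T.K (placeOf (pilotDataOfK T.D T.K) pp.1 x) / localDegree T.K (placeOf (pilotDataOfK T.D T.K) pp.1 x))
      (_htq : ∀ (pp : Nat.Primes) (x : (thetaIndex (pilotDataOfK T.D T.K)).Fibre (.inr pp)),
        haveI : Fact (pp : ℕ).Prime := ⟨pp.2⟩
        Real.log ‖tq pp x‖ = -((pilotDataOfK T.D T.K).qPilot (placeOf (pilotDataOfK T.D T.K) pp.1 x)) *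
          logNorm T.K (placeOf (pilotDataOfK T.D T.K) pp.1 x) / localDegree T.K (placeOf (pilotDataOfK T.D T.K) pp.1 x)),
      Thm311ToCor312.Licence
        (settingPrVolSharp (pilotDataOfK T.D T.K) hlog M archPk archSub Ψ act Mmod region n lat sig split qData tq t htq0 htq1) := by
  rcases hl with rfl | rfl | rfl | rfl
  · exact WRow.licence_triple_unconditional_slot isABCTriple_frey73 (by rw [Cor22.jInv_ratPoint_triple isABCTriple_frey73]; norm_num) T
      (fun p => if p = 3 then 5 else if p = 7 then 1 else if p = 103 then 0 else 0)
      (fun p => if p = 3 then 6 else if p = 7 then 2 else if p = 103 then (if (5 : ℕ) = 5 then 1 else 0) else 1) (WRow.hcell_frey73_small57 (Or.inl rfl))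
  · exact WRow.licence_triple_unconditional_slot isABCTriple_frey73 (by rw [Cor22.jInv_ratPoint_triple isABCTriple_frey73]; norm_num) T
      (fun p => if p = 3 then 5 else if p = 7 then 1 else if p = 103 then 0 else 0)
      (fun p => if p = 3 then 6 else if p = 7 then 2 else if p = 103 then (if (7 : ℕ) = 5 then 1 else 0) else 1) (WRow.hcell_frey73_small57 (Or.inr rfl))
  · exact WRow.licence_triple_unconditional_slot isABCTriple_frey73 (by rw [Cor22.jInv_ratPoint_triple isABCTriple_frey73]; norm_num) T
      (fun p => if p = 3 then 5 else if p = 7 then (if (17 : ℕ) = 17 then 2 else 3) else if p = 103 then 1 else 0)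
      (fun p => if p = 3 then 6 else if p = 7 then (if (17 : ℕ) = 17 then 2 else 4) else if p = 103 then 2 else 1) (WRow.hcell_frey73_small1723 (Or.inl rfl))
  · exact WRow.licence_triple_unconditional_slot isABCTriple_frey73 (by rw [Cor22.jInv_ratPoint_triple isABCTriple_frey73]; norm_num) T
      (fun p => if p = 3 then 5 else if p = 7 then (if (23 : ℕ) = 17 then 2 else 3) else if p = 103 then 1 else 0)
      (fun p => if p = 3 then 6 else if p = 7 then (if (23 : ℕ) = 17 then 2 else 4) else if p = 103 then 2 else 1) (WRow.hcell_frey73_small1723 (Or.inr rfl))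

/-- **BRANCH C's PER-DATUM ANTECEDENT «∃ ρ qK, QPinned ∧ PilotKummerCompatHull» at every genuine datum over `(ratPoint (73/5973865915867209), l)`,
`l ∈ {5, 7, 17, 23}`** (any columns `col`; every pair of realising Θ- and q-ideles): the per-datum S_H object of the certificates of record
(p453137 / p450130 / p447945) HOLDS at these datum classes, UNCONDITIONALLY.
[cite: Mochizuki2012, IUTchIII Cor. 3.12 Step (xi-d) p. 183, (xi-f) p. 184] [cite: DupuyHilado2025, §3.3, §3.4, §4.9] [claim: Mochizuki2012, status: disputed] -/
theorem WRow.exists_qPinned_and_hull_frey73_small (l : ℕ) (hl : l = 5 ∨ l = 7 ∨ l = 17 ∨ l = 23)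
    (T : Cor22.ThetaVolumeDatumAt (ratPoint (((73 : ℕ) : ℚ) / (5973865915867209 : ℕ))) l) :
    letI := T.instFieldF; letI := T.instNumberFieldF; letI := T.instAlgebraF; letI := T.instFieldK
    letI := T.instNumberFieldK; letI := T.instAlgebraK; letI := T.instFieldFbar; letI := T.instAlgebraFbar
    letI := T.instAlgebraKFbar; letI := T.instIsElliptic
    ∀ {logv : PadicLogs T.K} (hlog : LogvAnalytic logv) (M : Type) [Field M] [NumberField M]
      (archPk : ∀ (j : (thetaIndex (pilotDataOfK T.D T.K)).Label) (vQ : (thetaIndex (pilotDataOfK T.D T.K)).VQ),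
        Set ((logShellsDH (pilotDataOfK T.D T.K) logv).Packet j vQ))
      (archSub : ∀ (j : (thetaIndex (pilotDataOfK T.D T.K)).Label) (v : (thetaIndex (pilotDataOfK T.D T.K)).V),
        Set ((logShellsDH (pilotDataOfK T.D T.K) logv).Packet j ((thetaIndex (pilotDataOfK T.D T.K)).over v)))
      (Ψ : ℤ → ∀ v : (thetaIndex (pilotDataOfK T.D T.K)).V, v ∈ (thetaIndex (pilotDataOfK T.D T.K)).Vbad →
        Set ((logShellsDH (pilotDataOfK T.D T.K) logv).StarPacket v))
      (act : ℤ → ∀ v : (thetaIndex (pilotDataOfK T.D T.K)).V, v ∈ (thetaIndex (pilotDataOfK T.D T.K)).Vbad →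
        (logShellsDH (pilotDataOfK T.D T.K) logv).StarPacket v → Module.End ℚ ((logShellsDH (pilotDataOfK T.D T.K) logv).StarPacket v))
      (Mmod : ℤ → ∀ j : (thetaIndex (pilotDataOfK T.D T.K)).LabelStar, Set ((logShellsDH (pilotDataOfK T.D T.K) logv).GlobalPacket j.1))
      (region : ℤ → ∀ j : (thetaIndex (pilotDataOfK T.D T.K)).LabelStar, FinDivisor M → ∀ vQ : (thetaIndex (pilotDataOfK T.D T.K)).VQ,
        Set ((logShellsDH (pilotDataOfK T.D T.K) logv).Packet j.1 vQ))
      (n : ℤ) {HT : Type} {LogLink : HT → HT → Type} {IsFull : ∀ {s t : HT}, LogLink s t → Prop}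
      (lat : LGPGaussianLogThetaLattice LogLink IsFull)
      {Frd : Type} {IsoF : Frd → Frd → Type} {Ob : Frd → Type} {realify : Frd → Frd} {Strip : Type}
      {IsoS : Strip → Strip → Type} {Mv : ∀ v : (thetaIndex (pilotDataOfK T.D T.K)).V, v ∈ (thetaIndex (pilotDataOfK T.D T.K)).Vbad → Type}
      [∀ v h, Monoid (Mv v h)]
      (sig : GlobalLGPFrobenioidSignature (thetaIndex (pilotDataOfK T.D T.K)).lstar (thetaIndex (pilotDataOfK T.D T.K)).V
        (· ∈ (thetaIndex (pilotDataOfK T.D T.K)).Vbad) Frd IsoF Ob realify Strip IsoS Mv)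
      (split : SplittingMonoids Mv) {ObΔ : Type} {N : ∀ v : (thetaIndex (pilotDataOfK T.D T.K)).V, v ∈ (thetaIndex (pilotDataOfK T.D T.K)).Vbad → Type}
      [∀ v h, Monoid (N v h)] (qData : QPilotData ObΔ N)
      (tq : ∀ (pp : Nat.Primes) (x : (thetaIndex (pilotDataOfK T.D T.K)).Fibre (.inr pp)),
        haveI : Fact (pp : ℕ).Prime := ⟨pp.2⟩; kOf (pilotDataOfK T.D T.K) pp.1 x)
      (t : ∀ (pp : Nat.Primes) (_ : Fin (pilotDataOfK T.D T.K).lstar) (x : (thetaIndex (pilotDataOfK T.D T.K)).Fibre (.inr pp)),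
        haveI : Fact (pp : ℕ).Prime := ⟨pp.2⟩; kOf (pilotDataOfK T.D T.K) pp.1 x)
      (htq0 : ∀ pp x, tq pp x ≠ 0)
      (htq1 : ∀ (pp : Nat.Primes) (x : (thetaIndex (pilotDataOfK T.D T.K)).Fibre (.inr pp)),
        haveI : Fact (pp : ℕ).Prime := ⟨pp.2⟩; placeOf (pilotDataOfK T.D T.K) pp.1 x ∉ (pilotDataOfK T.D T.K).S → ‖tq pp x‖ = 1)
      (col : ℤ → Column (logShellsDH (pilotDataOfK T.D T.K) logv))
      (_ht0 : ∀ pp i x, t pp i x ≠ 0)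
      (_ht : ∀ (pp : Nat.Primes) (i : Fin (pilotDataOfK T.D T.K).lstar) (x : (thetaIndex (pilotDataOfK T.D T.K)).Fibre (.inr pp)),
        haveI : Fact (pp : ℕ).Prime := ⟨pp.2⟩
        Real.log ‖t pp i x‖ = -((pilotDataOfK T.D T.K).thetaPilot i (placeOf (pilotDataOfK T.D T.K) pp.1 x)) *
          logNorm T.K (placeOf (pilotDataOfK T.D T.K) pp.1 x) / localDegree T.K (placeOf (pilotDataOfK T.D T.K) pp.1 x))
      (_htq : ∀ (pp : Nat.Primes) (x : (thetaIndex (pilotDataOfK T.D T.K)).Fibre (.inr pp)),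
        haveI : Fact (pp : ℕ).Prime := ⟨pp.2⟩
        Real.log ‖tq pp x‖ = -((pilotDataOfK T.D T.K).qPilot (placeOf (pilotDataOfK T.D T.K) pp.1 x)) *
          logNorm T.K (placeOf (pilotDataOfK T.D T.K) pp.1 x) / localDegree T.K (placeOf (pilotDataOfK T.D T.K) pp.1 x)),
      ∃ (ρ : (∀ v : (thetaIndex (pilotDataOfK T.D T.K)).V, v ∈ (thetaIndex (pilotDataOfK T.D T.K)).Vbad →
              Set ((logShellsDH (pilotDataOfK T.D T.K) logv).StarPacket v)) →
            ∀ (j : (thetaIndex (pilotDataOfK T.D T.K)).Label) (vQ : (thetaIndex (pilotDataOfK T.D T.K)).VQ),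
              Set ((logShellsDH (pilotDataOfK T.D T.K) logv).Packet j vQ))
          (qK : ∀ v : (thetaIndex (pilotDataOfK T.D T.K)).V, v ∈ (thetaIndex (pilotDataOfK T.D T.K)).Vbad →
            Set ((logShellsDH (pilotDataOfK T.D T.K) logv).StarPacket v)),
          QPinned ({ toSituation := situationPrVol (pilotDataOfK T.D T.K) hlog M archPk archSub Ψ act Mmod region, col := col } :
              LatticeSituation (thetaIndex (pilotDataOfK T.D T.K)))
            (settingPrVolSharp (pilotDataOfK T.D T.K) hlog M archPk archSub Ψ act Mmod region n lat sig split qData tq t htq0 htq1) ρ qK ∧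
          PilotKummerCompatHull ({ toSituation := situationPrVol (pilotDataOfK T.D T.K) hlog M archPk archSub Ψ act Mmod region, col := col } :
              LatticeSituation (thetaIndex (pilotDataOfK T.D T.K)))
            (settingPrVolSharp (pilotDataOfK T.D T.K) hlog M archPk archSub Ψ act Mmod region n lat sig split qData tq t htq0 htq1) ρ qK := by
  rcases hl with rfl | rfl | rfl | rfl
  · exact WRow.exists_qPinned_and_hull_triple_unconditional_slot isABCTriple_frey73 (by rw [Cor22.jInv_ratPoint_triple isABCTriple_frey73]; norm_num) T
      (fun p => if p = 3 then 5 else if p = 7 then 1 else if p = 103 then 0 else 0)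
      (fun p => if p = 3 then 6 else if p = 7 then 2 else if p = 103 then (if (5 : ℕ) = 5 then 1 else 0) else 1) (WRow.hcell_frey73_small57 (Or.inl rfl))
  · exact WRow.exists_qPinned_and_hull_triple_unconditional_slot isABCTriple_frey73 (by rw [Cor22.jInv_ratPoint_triple isABCTriple_frey73]; norm_num) T
      (fun p => if p = 3 then 5 else if p = 7 then 1 else if p = 103 then 0 else 0)
      (fun p => if p = 3 then 6 else if p = 7 then 2 else if p = 103 then (if (7 : ℕ) = 5 then 1 else 0) else 1) (WRow.hcell_frey73_small57 (Or.inr rfl))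
  · exact WRow.exists_qPinned_and_hull_triple_unconditional_slot isABCTriple_frey73 (by rw [Cor22.jInv_ratPoint_triple isABCTriple_frey73]; norm_num) T
      (fun p => if p = 3 then 5 else if p = 7 then (if (17 : ℕ) = 17 then 2 else 3) else if p = 103 then 1 else 0)
      (fun p => if p = 3 then 6 else if p = 7 then (if (17 : ℕ) = 17 then 2 else 4) else if p = 103 then 2 else 1) (WRow.hcell_frey73_small1723 (Or.inl rfl))
  · exact WRow.exists_qPinned_and_hull_triple_unconditional_slot isABCTriple_frey73 (by rw [Cor22.jInv_ratPoint_triple isABCTriple_frey73]; norm_num) T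
      (fun p => if p = 3 then 5 else if p = 7 then (if (23 : ℕ) = 17 then 2 else 3) else if p = 103 then 1 else 0)
      (fun p => if p = 3 then 6 else if p = 7 then (if (23 : ℕ) = 17 then 2 else 4) else if p = 103 then 2 else 1) (WRow.hcell_frey73_small1723 (Or.inr rfl))

end Summit.ABC.IUTFork.Conditional

end
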